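import Literature.Geometry.Symplectic.SphereCROperatorDerivativeAt
import Literature.Geometry.Symplectic.SphereCRLinearRegularity
import Literature.Geometry.Symplectic.SphereCRSolutionLevels
import Literature.Analysis.Complex.RiemannSphereLocalRegularityLift
import HarnessLib

/-!
# Regularity of solutions of the linearised chart equation at a member of the family

Layer B7c (assembly) of the analytic core of the Hofer–Lizan–Sikorav local foliation theorem
(Wendl 2018, Thm. 2.46; lead of crux `WitnessCharge`, summit `SmoothPoincare4`). Let
`y₁ : SecPair k r` (`k ≥ 1`) be a small honest solution of the chart Cauchy–Riemann equations on
the discs of radius `3` with invertible transports (a member of the implicit-function family,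
`SphereCRFamilySolutions`). If, for a direction `w : SecPair k r`, the four pieces of the
derivatives `dPT y₁ w`, `dPN y₁ w` of the Banach maps (`SphereCROperatorBanach`) are of class
`C^{m,r}`, then the four pieces of `w` are of class `C^{m+1,r}`
(`memContDiffHolder_succ_pieces_of_linearised`). Proof: chartwise the derivative is the first
variation (`dout₀_apply_of_sol`, `SphereCROperatorDerivativeAt`), so the local linear regularity
theorem `locHolder_succ_of_linearised` (`SphereCRLinearRegularity`) raises the local class of the
representatives of `w` at every point of both discs of radius `3`, and the local-to-global lift
`memContDiffHolder_pieces_of_forall_exists` (`RiemannSphereLocalRegularityLift`) concludes. This is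
the surjectivity half of "the linearisation stays an isomorphism at every Hölder level".

## References

* C. Wendl, *Holomorphic Curves in Low Dimensions*, LNM 2216 (2018), §2.3, Thm. 2.46. [Wendl2018]
* D. McDuff, D. Salamon, *J-holomorphic curves and symplectic topology* (2012), Thm. B.4.1.
  [McDuffSalamon2012]
-/

noncomputable section

open Set Filter Metric Function Complex
open scoped Topology NNReal ContDiff
open Literature.Analysis.FunctionSpaces Literature.Analysis.Complex.RiemannSphere
open Literature.Analysis.Complex.ProjectiveLineExpChart Literature.Geometry.Symplectic.CRExpression
open Literature.Analysis.Complex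

namespace Literature.Geometry.Symplectic

namespace SphereCR

namespace SphereACData

variable (𝒥 : SphereACData) {r : ℝ≥0} {k : ℕ}

/-- `ρ > 0` on the open disc of radius `3`. [folklore] -/
theorem rhoCut_pos_of_norm_lt_three {z : ℂ} (hz : ‖z‖ < 3) : 0 < rhoCut z :=
  rhoCutBump.pos_of_mem_ball (by simpa [rhoCutBump] using hz)

/-- The derivative of the chart-`0` output is the pair of the first pieces of `dPT` and `dPN`.
[folklore] -/
theorem dout₀_apply_eq_mk (hr : r ≤ 1) (y δ : SecPair k r) (z : ℂ) :
    𝒥.dout₀ hr k y δ z = ((𝒥.dPT hr k y δ).1 z, (𝒥.dPN hr k y δ).1 z) := rfl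

/-- The derivative of the chart-`1` output is the pair of the second pieces of `dPT` and `dPN`.
[folklore] -/
theorem dout₁_apply_eq_mk (hr : r ≤ 1) (y δ : SecPair k r) (w : ℂ) :
    𝒥.dout₁ hr k y δ w = ((𝒥.dPT hr k y δ).2 w, (𝒥.dPN hr k y δ).2 w) := rfl

/-- **Regularity for the linearised chart equation at a small solution.** Let `y₁ : SecPair k r`
(`k ≥ 1`, `0 < r < 1`) be small, with `den ≠ 0` and invertible transports along its
representatives on the discs of radius `3`, solving `crExpr 𝒥.J₀ (𝒥.vmap₀ ξ₁⁰ f₁⁰) = 0` on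
`‖z‖ < 3` and `crExpr 𝒥.J₁ (𝒥.vmap₁ ξ₁¹ f₁¹) = 0` on `‖w‖ < 3`. If for a direction `w` the pieces
of `dPT y₁ w` and `dPN y₁ w` are of class `C^{m,r}`, then the pieces of `w` are of class
`C^{m+1,r}`. [cite: Wendl2018, Thm. 2.46] -/
theorem memContDiffHolder_succ_pieces_of_linearised (hr0 : 0 < r) (hr1 : r < 1) (hk : 1 ≤ k)
    {y₁ : SecPair k r} (hy : Small hr1.le k y₁)
    (hU₀ : ∀ z : ℂ, ‖z‖ < 3 → den z (sec₀ (fun w : ℂ => -w ^ 2) y₁.1.1 z) ≠ 0 ∧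
      IsUnit (𝒥.PhiJet₀ z (sec₀ (fun w : ℂ => -w ^ 2) y₁.1.1 z) (sec₀ (1 : ℂ → ℂ) y₁.2.1 z)))
    (hU₁ : ∀ w : ℂ, ‖w‖ < 3 → den w (sec₁ (fun w : ℂ => -w ^ 2) y₁.1.1 w) ≠ 0 ∧
      IsUnit (𝒥.PhiJet₁ w (sec₁ (fun w : ℂ => -w ^ 2) y₁.1.1 w) (sec₁ (1 : ℂ → ℂ) y₁.2.1 w)))
    (hsol₀ : ∀ z : ℂ, ‖z‖ < 3 →
      crExpr 𝒥.J₀ (𝒥.vmap₀ (sec₀ (fun w : ℂ => -w ^ 2) y₁.1.1) (sec₀ (1 : ℂ → ℂ) y₁.2.1)) z = 0)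
    (hsol₁ : ∀ w : ℂ, ‖w‖ < 3 →
      crExpr 𝒥.J₁ (𝒥.vmap₁ (sec₁ (fun w : ℂ => -w ^ 2) y₁.1.1) (sec₁ (1 : ℂ → ℂ) y₁.2.1)) w = 0)
    (w : SecPair k r) {m : ℕ}
    (hT₁ : MemContDiffHolder m r ((𝒥.dPT hr1.le k y₁ w).1 : ℂ → ℂ))
    (hT₂ : MemContDiffHolder m r ((𝒥.dPT hr1.le k y₁ w).2 : ℂ → ℂ))
    (hN₁ : MemContDiffHolder m r ((𝒥.dPN hr1.le k y₁ w).1 : ℂ → ℂ))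
    (hN₂ : MemContDiffHolder m r ((𝒥.dPN hr1.le k y₁ w).2 : ℂ → ℂ)) :
    MemContDiffHolder (m + 1) r (w.1.1.1 : ℂ → ℂ) ∧ MemContDiffHolder (m + 1) r (w.1.1.2 : ℂ → ℂ) ∧
      MemContDiffHolder (m + 1) r (w.2.1.1 : ℂ → ℂ) ∧ MemContDiffHolder (m + 1) r (w.2.1.2 : ℂ → ℂ) := by
  have hr : r ≤ 1 := hr1.le
  obtain ⟨hsξ₀, hsξ₁, hsf₀, hsf₁⟩ := 𝒥.contDiff_sec_of_sol hr0 hr1 y₁ (fun z hz => (hU₀ z hz).1)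
    (fun w hw => (hU₁ w hw).1) hsol₀ hsol₁
  have hball : ∀ {z₀ : ℂ}, ‖z₀‖ < 3 → ∀ᶠ z in 𝓝 z₀, ‖z‖ < 3 := fun hz₀ =>
    (isOpen_lt continuous_norm continuous_const).mem_nhds hz₀
  -- chart `0`: local class `m + 1` of the `z`-representatives of `w` on the disc of radius `3`
  have h₀ : ∀ z₀ : ℂ, ‖z₀‖ < 3 →
      (∃ W, MemContDiffHolder (m + 1) r W ∧ W =ᶠ[𝓝 z₀] sec₀ (fun w : ℂ => -w ^ 2) w.1.1) ∧
        ∃ W, MemContDiffHolder (m + 1) r W ∧ W =ᶠ[𝓝 z₀] sec₀ (1 : ℂ → ℂ) w.2.1 := by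
    intro z₀ hz₀
    refine 𝒥.locHolder_succ_of_linearised hr0 hr1 hsξ₀ hsf₀ ((hball hz₀).mono fun z hz => hU₀ z hz)
      contDiff_rhoCut (rhoCut_pos_of_norm_lt_three hz₀).ne'
      (locHolder_of_le hr (Nat.le_add_left 1 k)
        (locHolder_sec₀ hr w.1.2 neg_sq_clutch_ne_zero contDiffOn_neg_sq_clutch z₀))
      (locHolder_of_le hr (Nat.le_add_left 1 k)
        (locHolder_sec₀ hr w.2.2 one_clutch_ne_zero contDiffOn_one_clutch z₀))
      (G := fun z => (((𝒥.dPT hr k y₁ w).1 z, (𝒥.dPN hr k y₁ w).1 z) : ℂ × ℂ))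
      ⟨_, hT₁.prodMk hN₁, EventuallyEq.rfl⟩ ?_
    filter_upwards [hball hz₀] with z hz
    rw [← 𝒥.dout₀_apply_eq_mk hr, 𝒥.dout₀_apply_of_sol hk hy hsol₀ w hz]
  -- chart `1`
  have h₁ : ∀ w₀ : ℂ, ‖w₀‖ < 3 →
      (∃ W, MemContDiffHolder (m + 1) r W ∧ W =ᶠ[𝓝 w₀] sec₁ (fun w : ℂ => -w ^ 2) w.1.1) ∧
        ∃ W, MemContDiffHolder (m + 1) r W ∧ W =ᶠ[𝓝 w₀] sec₁ (1 : ℂ → ℂ) w.2.1 := by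
    intro w₀ hw₀
    refine 𝒥.locHolder_succ_of_linearised₁ hr0 hr1 hsξ₁ hsf₁
      ((hball hw₀).mono fun w' hw' => hU₁ w' hw') contDiff_rhoCut
      (rhoCut_pos_of_norm_lt_three hw₀).ne'
      (locHolder_of_le hr (Nat.le_add_left 1 k) (locHolder_sec₁ hr w.1.2 contDiffOn_neg_sq_clutch w₀))
      (locHolder_of_le hr (Nat.le_add_left 1 k) (locHolder_sec₁ hr w.2.2 contDiffOn_one_clutch w₀))
      (G := fun w' => (((𝒥.dPT hr k y₁ w).2 w', (𝒥.dPN hr k y₁ w).2 w') : ℂ × ℂ))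
      ⟨_, hT₂.prodMk hN₂, EventuallyEq.rfl⟩ ?_
    filter_upwards [hball hw₀] with w' hw'
    rw [← 𝒥.dout₁_apply_eq_mk hr, 𝒥.dout₁_apply_of_sol hk hy hsol₁ w hw']
    rfl
  -- local to global
  obtain ⟨a, b⟩ := memContDiffHolder_pieces_of_forall_exists (m := m + 1) hr neg_sq_clutch_ne_zero
    contDiffOn_neg_sq_clutch w.1 (fun z hz => (h₀ z hz).1) (fun w' hw' => (h₁ w' hw').1)
  obtain ⟨c, d⟩ := memContDiffHolder_pieces_of_forall_exists (m := m + 1) hr one_clutch_ne_zero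
    contDiffOn_one_clutch w.2 (fun z hz => (h₀ z hz).2) (fun w' hw' => (h₁ w' hw').2)
  exact ⟨a, b, c, d⟩

end SphereACData

end SphereCR

end Literature.Geometry.Symplectic

end
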